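import Summits.BirchSwinnertonDyer.BirchSwinnertonDyer.Theorems.ManinLocalTwoThreeManinPrimeToThreeAtNineInhabited
import Summits.BirchSwinnertonDyer.BirchSwinnertonDyer.Theorems.ManinLocalTwoThreeOmegaStableTwentySeven
import Literature.NumberTheory.EllipticCurves.UniformizationUniqueProofs
import Literature.NumberTheory.EllipticCurves.ModularSymbolsProofs
import Literature.NumberTheory.EllipticCurves.GlobalMinimalModel
import HarnessLib

/-!
# The hexagonal squeeze at level 27: `Λ(φ₂₇) ⊆ Λ(0, 27) ⟹ |c| = 1` on `X₀(27)`, fact-free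

Cell bsd-f2-manin, E-an-g49 («Ligozat-27 in the kernel», Sketch-an-g49 §0–§5), landed def-free.  At
`N = 27` every datum has `f = φ₂₇ = η(3τ)²η(9τ)²` (`NonVacuityTwentySeven.f_eq_etaProductTwentySeven`);
(S1) `e^{2πi/3} Λ(φ₂₇) ⊆ Λ(φ₂₇)` is the tree theorem
`OmegaStableTwentySeven.omegaStable_periodLattice_twentySeven`; (S2) `Λ(φ₂₇) ⊆ Λ₁` for a period pair
with `g₂ = 0`, `g₃ = 27` (the Néron lattice of `27a1`) is the explicit hypothesis `h2` (its `η`-certificate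
`X = η(9τ)⁴/(η(3τ)η(27τ)³)`, `Z² = 4X³ − 27`, `q dX/dq = φ₂₇ Z` is not yet typed).  THEOREM: (S2) ⟹
`|c(D)| = 1` for every globally minimal `W/ℚ` and every `D : ModularParametrizationData W 27` with the
lattice clause — no modularity binder, no Calegari–Dimitrov–Tang: `Λ_W ⊆ cΛ₁` are both `ℤ[ω]`-stable, so
`Λ_W = ν·cΛ₁`, `ν ∈ ℤ[ω]`; then `c₄ = 0`, `c₆ (cν)⁶ = 5832`, and `1728Δ = −c₆²` forces `c² = 1`.
-/

set_option autoImplicit false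
set_option linter.dupNamespace false

noncomputable section

open scoped MatrixGroups ModularForm Topology Real
open Filter CongruenceSubgroup WeierstrassCurve Function Complex
open UpperHalfPlane hiding I
open Literature.NumberTheory.EllipticCurves Literature.NumberTheory.EllipticCurves.ModularForms

namespace Summit.BirchSwinnertonDyer.BirchSwinnertonDyer.Theorems.ManinLocalTwoThree.HexagonalSqueezeTwentySeven

/-! ## §0 The cube root of unity `e^{2πi/3}` -/

/-- `e^{2πi/3} = e^{(2π/3) i}` with a real argument. [folklore] -/
theorem cexp_twoPiI_div_three_eq : cexp (2 * π * I / 3) = cexp (↑(2 * π / 3 : ℝ) * I) := by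
  congr 1; push_cast; ring

/-- `re e^{2πi/3} = −1/2`. [folklore] -/
theorem cexp_twoPiI_div_three_re : (cexp (2 * π * I / 3)).re = -1 / 2 := by
  rw [cexp_twoPiI_div_three_eq, Complex.exp_ofReal_mul_I_re]
  have : (2 * π / 3 : ℝ) = π - π / 3 := by ring
  rw [this, Real.cos_pi_sub, Real.cos_pi_div_three]; ring

/-- `im e^{2πi/3} = √3/2`. [folklore] -/
theorem cexp_twoPiI_div_three_im : (cexp (2 * π * I / 3)).im = Real.sqrt 3 / 2 := by
  rw [cexp_twoPiI_div_three_eq, Complex.exp_ofReal_mul_I_im]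
  have : (2 * π / 3 : ℝ) = π - π / 3 := by ring
  rw [this, Real.sin_pi_sub, Real.sin_pi_div_three]

/-- `(e^{2πi/3})⁶ = 1`. [folklore] -/
theorem cexp_twoPiI_div_three_pow_six : cexp (2 * π * I / 3) ^ 6 = 1 := by
  rw [show (6 : ℕ) = 3 * 2 from rfl, pow_mul, OmegaStableTwentySeven.omega_pow_three, one_pow]

/-! ## §1 Eisenstein coordinates and the hexagonal lattice lemma

Throughout §1, `ω` is any complex number with `re ω = −1/2` and `im ω = √3/2`. -/

variable {ω : ℂ}

/-- `im ω > 0`. [folklore] -/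
theorem im_pos_of_im_eq (him : ω.im = Real.sqrt 3 / 2) : 0 < ω.im := by
  rw [him]; positivity

/-- `(im ω)² = 3/4`. [folklore] -/
theorem im_sq_of_im_eq (him : ω.im = Real.sqrt 3 / 2) : ω.im ^ 2 = 3 / 4 := by
  rw [him, div_pow, Real.sq_sqrt (by norm_num)]; norm_num

/-- `N(ω) = 1`. [folklore] -/
theorem normSq_eq_one_of_re_im (hre : ω.re = -1 / 2) (him : ω.im = Real.sqrt 3 / 2) :
    Complex.normSq ω = 1 := by
  rw [Complex.normSq_apply, hre]
  nlinarith [im_sq_of_im_eq him]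

/-- `ω ≠ 0`. [folklore] -/
theorem ne_zero_of_re_im (hre : ω.re = -1 / 2) (him : ω.im = Real.sqrt 3 / 2) : ω ≠ 0 := by
  intro h; have := normSq_eq_one_of_re_im hre him; rw [h, map_zero] at this; exact zero_ne_one this

/-- `N(s + tω) = s² − st + t²` for real `s, t`. [folklore] -/
theorem normSq_add_mul (hre : ω.re = -1 / 2) (him : ω.im = Real.sqrt 3 / 2) (s t : ℝ) :
    Complex.normSq ((s : ℂ) + t * ω) = s ^ 2 - s * t + t ^ 2 := by
  rw [Complex.normSq_apply]
  simp only [Complex.add_re, Complex.add_im, Complex.ofReal_re, Complex.ofReal_im,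
    Complex.mul_re, Complex.mul_im, hre, zero_mul, sub_zero, add_zero, zero_add]
  nlinarith [im_sq_of_im_eq him]

/-- Every complex number is `s + tω` with `s, t` real. [folklore] -/
theorem exists_real_coords (him : ω.im = Real.sqrt 3 / 2) (y : ℂ) :
    ∃ s t : ℝ, y = (s : ℂ) + t * ω := by
  refine ⟨y.re - y.im / ω.im * ω.re, y.im / ω.im, ?_⟩
  apply Complex.ext
  · simp [Complex.add_re, Complex.mul_re]
  · simp only [Complex.add_im, Complex.ofReal_im, Complex.mul_im, Complex.ofReal_re, zero_add,
      zero_mul, add_zero]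
    field_simp [(im_pos_of_im_eq him).ne']

/-- Rounding in `ℤ[ω]`: every `y` is within `N(·) < 1` of an Eisenstein integer. [folklore] -/
theorem exists_eisenstein_near (hre : ω.re = -1 / 2) (him : ω.im = Real.sqrt 3 / 2) (y : ℂ) :
    ∃ a b : ℤ, Complex.normSq (y - (a + b * ω)) < 1 := by
  obtain ⟨s, t, rfl⟩ := exists_real_coords him y
  refine ⟨round s, round t, ?_⟩
  have h : ((s : ℂ) + t * ω) - ((round s : ℤ) + (round t : ℤ) * ω)
      = ((s - round s : ℝ) : ℂ) + ((t - round t : ℝ) : ℂ) * ω := by push_cast; ring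
  rw [h, normSq_add_mul hre him]
  have hs := abs_sub_round s
  have ht := abs_sub_round t
  set σ := s - round s
  set τ := t - round t
  have hσ2 : σ ^ 2 ≤ 1 / 4 := by nlinarith [abs_nonneg σ, sq_abs σ]
  have hτ2 : τ ^ 2 ≤ 1 / 4 := by nlinarith [abs_nonneg τ, sq_abs τ]
  have hστ : -(σ * τ) ≤ 1 / 4 := by
    have : |σ * τ| ≤ 1 / 2 * (1 / 2) := by
      rw [abs_mul]; exact mul_le_mul hs ht (abs_nonneg _) (by norm_num)
    have := neg_abs_le (σ * τ)
    linarith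
  nlinarith

/-- Finitely many lattice vectors in a ball. [folklore] -/
theorem finite_short_vectors (L : PeriodPair) (R : ℝ) :
    Set.Finite ({x : ℂ | ‖x‖ ≤ R} ∩ (L.lattice : Set ℂ)) := by
  refine Metric.finite_isBounded_inter_isClosed ?_ ?_ ?_
  · exact isDiscrete_iff_discreteTopology.mpr (inferInstance : DiscreteTopology L.lattice)
  · exact (Metric.isBounded_closedBall (x := (0 : ℂ)) (r := R)).subset fun x hx ↦ by
      simpa using hx
  · haveI : DiscreteTopology L.lattice.toAddSubgroup :=
      (inferInstance : DiscreteTopology L.lattice)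
    exact AddSubgroup.isClosed_of_discrete (H := L.lattice.toAddSubgroup)

/-- A shortest nonzero vector exists. -/
theorem exists_shortest (L : PeriodPair) :
    ∃ ℓ ∈ L.lattice, ℓ ≠ 0 ∧ ∀ x ∈ L.lattice, x ≠ 0 → ‖ℓ‖ ≤ ‖x‖ := by
  have hω₁ : L.ω₁ ≠ 0 := by simpa using L.indep.ne_zero 0
  have hfin := (finite_short_vectors L ‖L.ω₁‖).inter_of_left {x : ℂ | x ≠ 0}
  set S := ({x : ℂ | ‖x‖ ≤ ‖L.ω₁‖} ∩ (L.lattice : Set ℂ)) ∩ {x : ℂ | x ≠ 0} with hS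
  have hne : S.Nonempty :=
    ⟨L.ω₁, ⟨(show L.ω₁ ∈ {x : ℂ | ‖x‖ ≤ ‖L.ω₁‖} from le_refl ‖L.ω₁‖), L.ω₁_mem_lattice⟩, hω₁⟩
  obtain ⟨ℓ, hℓS, hmin⟩ := hfin.exists_minimalFor (fun x : ℂ ↦ ‖x‖) S hne
  refine ⟨ℓ, hℓS.1.2, hℓS.2, fun x hx hx0 ↦ ?_⟩
  by_cases hxs : ‖x‖ ≤ ‖L.ω₁‖
  · have hxS : x ∈ S := ⟨⟨hxs, hx⟩, hx0⟩
    by_contra hlt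
    push Not at hlt
    have := hmin hxS hlt.le
    exact absurd this (not_le.mpr hlt)
  · push Not at hxs
    exact (hℓS.1.1.trans hxs.le)


/-- **Hexagonal lattice lemma.** If a rank-two lattice `Λ ⊂ ℂ` is stable under multiplication by
`ω = e^{2πi/3}`, then `Λ = ℤ[ω] · ℓ` for any shortest nonzero vector `ℓ` (covering radius of the
hexagonal lattice `< 1`). [folklore] -/
theorem exists_hexGenerator (hre : ω.re = -1 / 2) (him : ω.im = Real.sqrt 3 / 2) (L : PeriodPair)
    (hω : ∀ z ∈ L.lattice, ω * z ∈ L.lattice) :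
    ∃ ℓ : ℂ, ℓ ≠ 0 ∧ ∀ x, x ∈ L.lattice ↔ ∃ a b : ℤ, x = (a + b * ω) * ℓ := by
  obtain ⟨ℓ, hℓ, hℓ0, hmin⟩ := exists_shortest L
  refine ⟨ℓ, hℓ0, fun x ↦ ⟨fun hx ↦ ?_, ?_⟩⟩
  · obtain ⟨a, b, hab⟩ := exists_eisenstein_near hre him (x / ℓ)
    refine ⟨a, b, ?_⟩
    -- the difference is a lattice vector shorter than `ℓ`
    set δ := x / ℓ - (a + b * ω) with hδ
    have hz : x - (a + b * ω) * ℓ = δ * ℓ := by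
      rw [hδ]; field_simp
    have hmem : x - (a + b * ω) * ℓ ∈ L.lattice := by
      have h1 : (a : ℂ) * ℓ ∈ L.lattice := by
        simpa [zsmul_eq_mul] using L.lattice.smul_mem a hℓ
      have h2 : (b : ℂ) * (ω * ℓ) ∈ L.lattice := by
        simpa [zsmul_eq_mul] using L.lattice.smul_mem b (hω ℓ hℓ)
      have : (a + b * ω) * ℓ = a * ℓ + b * (ω * ℓ) := by ring
      rw [this]
      exact L.lattice.sub_mem hx (L.lattice.add_mem h1 h2)
    by_contra hne
    have hne' : x - (a + b * ω) * ℓ ≠ 0 := sub_ne_zero.mpr hne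
    have hle := hmin _ hmem hne'
    rw [hz, norm_mul] at hle
    have hδ1 : ‖δ‖ < 1 := by
      have : ‖δ‖ ^ 2 < 1 := by rw [Complex.sq_norm]; exact hab
      nlinarith [norm_nonneg δ]
    have hℓpos : 0 < ‖ℓ‖ := norm_pos_iff.mpr hℓ0
    nlinarith
  · rintro ⟨a, b, rfl⟩
    have h1 : (a : ℂ) * ℓ ∈ L.lattice := by
      simpa [zsmul_eq_mul] using L.lattice.smul_mem a hℓ
    have h2 : (b : ℂ) * (ω * ℓ) ∈ L.lattice := by
      simpa [zsmul_eq_mul] using L.lattice.smul_mem b (hω ℓ hℓ)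
    have : (a + b * ω) * ℓ = a * ℓ + b * (ω * ℓ) := by ring
    rw [this]
    exact L.lattice.add_mem h1 h2

/-- **Homothety of nested hexagonal lattices.** If `M ⊆ P` are both `ω`-stable then `M = ν · P`
with `ν = a + bω ∈ ℤ[ω] ∖ 0`. [folklore] -/
theorem lattice_eq_mulLeft_of_omega_stable (hre : ω.re = -1 / 2) (him : ω.im = Real.sqrt 3 / 2)
    {M P : PeriodPair} (hM : ∀ z ∈ M.lattice, ω * z ∈ M.lattice) (hP : ∀ z ∈ P.lattice, ω * z ∈ P.lattice)
    (hle : M.lattice ≤ P.lattice) :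
    ∃ a b : ℤ, ∃ hν : ((a : ℂ) + b * ω) ≠ 0,
      M.lattice = (P.mulLeft ((a : ℂ) + b * ω) hν).lattice := by
  obtain ⟨m, hm0, hmgen⟩ := exists_hexGenerator hre him M hM
  obtain ⟨p, hp0, hpgen⟩ := exists_hexGenerator hre him P hP
  have hmP : m ∈ P.lattice := hle ((hmgen m).mpr ⟨1, 0, by simp⟩)
  obtain ⟨a, b, hab⟩ := (hpgen m).mp hmP
  have hν : ((a : ℂ) + b * ω) ≠ 0 := by
    intro h; rw [h, zero_mul] at hab; exact hm0 hab
  refine ⟨a, b, hν, ?_⟩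
  ext x
  rw [PeriodPair.mem_mulLeft_lattice, hmgen, hpgen]
  constructor
  · rintro ⟨a', b', rfl⟩
    refine ⟨a', b', ?_⟩
    rw [hab]; field_simp
  · rintro ⟨a', b', h⟩
    refine ⟨a', b', ?_⟩
    have : x = ((a : ℂ) + b * ω) * (((a' : ℂ) + b' * ω) * p) := by
      rw [← h]; field_simp
    rw [this, hab]; ring

/-! ## §2 The arithmetic endgame -/

/-- `1728 Δ = −m²`, `|m|·k³ = 5832` with `k = c²n`, `n ≥ 1` force `|c| = 1`
(`72 ∣ m`, so `k³ ∣ 81`, `k ∈ {1, 3}`). [folklore] -/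
theorem abs_eq_one_of_arith (m Δ c n : ℤ) (hn : 1 ≤ n) (hΔ : 1728 * Δ = -m ^ 2)
    (h : |m| * (c ^ 2 * n) ^ 3 = 5832) : |c| = 1 := by
  have h8 : (8 : ℤ) ∣ m := by
    have : (8 : ℤ) ^ 2 ∣ m ^ 2 := ⟨-27 * Δ, by linarith⟩
    exact (Int.pow_dvd_pow_iff two_ne_zero).mp this
  have h3 : (3 : ℤ) ∣ m :=
    Int.prime_three.dvd_of_dvd_pow (n := 2) ⟨-576 * Δ, by linarith⟩
  obtain ⟨m₁, rfl⟩ := h3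
  have h3' : (3 : ℤ) ∣ m₁ :=
    Int.prime_three.dvd_of_dvd_pow (n := 2) ⟨-64 * Δ, by linarith⟩
  obtain ⟨m₂, rfl⟩ := h3'
  have h8' : (8 : ℤ) ∣ m₂ := by omega
  obtain ⟨m₃, rfl⟩ := h8'
  have h72 : (3 : ℤ) * (3 * (8 * m₃)) = 72 * m₃ := by ring
  rw [h72, abs_mul, abs_of_pos (by norm_num : (0 : ℤ) < 72)] at h
  obtain ⟨μ, hμ⟩ : ∃ μ : ℤ, μ = |m₃| := ⟨_, rfl⟩
  obtain ⟨k, hk⟩ : ∃ k : ℤ, k = c ^ 2 * n := ⟨_, rfl⟩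
  rw [← hμ, ← hk] at h
  have hμ0 : 0 ≤ μ := hμ ▸ abs_nonneg _
  have hk0 : 0 ≤ k := by rw [hk]; positivity
  have h' : μ * k ^ 3 = 81 := by linarith
  have hk1 : 1 ≤ k := by
    by_contra hcon; rw [show k = 0 by omega] at h'; simp at h'
  have hμ1 : 1 ≤ μ := by
    by_contra hcon; rw [show μ = 0 by omega] at h'; simp at h'
  have hk4 : k ≤ 4 := by
    by_contra hcon
    have h5 : 5 ≤ k := by omega
    have h125 : (5 : ℤ) ^ 3 ≤ k ^ 3 := pow_le_pow_left₀ (by norm_num) h5 3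
    have : k ^ 3 ≤ μ * k ^ 3 := le_mul_of_one_le_left (by positivity) hμ1
    linarith
  have hc0 : c ≠ 0 := by
    rintro rfl
    simp at hk; omega
  have hcases : k = 1 ∨ k = 3 := by interval_cases k <;> omega
  -- `c² n ∈ {1, 3}` with `n ≥ 1`, `c ≠ 0` ⟹ `c² ≤ 3` ⟹ `|c| = 1`
  have hc2 : c ^ 2 ≤ 3 := by
    rcases hcases with h1 | h3 <;> nlinarith [sq_nonneg c]
  have hcb : -1 ≤ c ∧ c ≤ 1 := by constructor <;> nlinarith [sq_nonneg c]
  obtain ⟨hlo, hhi⟩ := hcb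
  interval_cases c <;> first | exact absurd rfl hc0 | simp

/-! ## §3 The hexagonal squeeze: (S2) ⟹ `|c| = 1` on `X₀(27)`, with (S1) discharged -/

/-- **Ligozat-27 in the kernel, modulo (S2).**  If the period lattice of `φ₂₇ = η(3τ)²η(9τ)²` lies in a
period pair with invariants `g₂ = 0`, `g₃ = 27`, then `|c(D)| = 1` for every globally minimal `W/ℚ` and
every `X₀(27)`-datum `D` of `W` with the lattice clause `Λ_W = c · Λ_f` — no modularity binder, no
Calegari–Dimitrov–Tang.  (S1) `e^{2πi/3} Λ(φ₂₇) ⊆ Λ(φ₂₇)` is the tree theorem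
`OmegaStableTwentySeven.omegaStable_periodLattice_twentySeven`. [folklore] -/
theorem abs_maninConstant_eq_one_twentySeven_of_periodLattice_le_hex
    (h2 : ∃ L₁ : PeriodPair, L₁.g₂ = 0 ∧ L₁.g₃ = 27 ∧
      ∀ z ∈ periodLattice cuspFormEtaProductTwentySeven, z ∈ L₁.lattice)
    (W : WeierstrassCurve ℚ) [W.IsGloballyMinimal] (D : ModularParametrizationData W 27)
    (hopt : ∀ z ∈ D.L.lattice, ∃ w ∈ periodLattice D.f, z = D.c * w) :
    |D.maninConstant| = 1 := by
  have h1 := OmegaStableTwentySeven.omegaStable_periodLattice_twentySeven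
  have hre := cexp_twoPiI_div_three_re
  have him := cexp_twoPiI_div_three_im
  have hω6 := cexp_twoPiI_div_three_pow_six
  have hω0 : cexp (2 * π * I / 3) ≠ 0 := ne_zero_of_re_im hre him
  set ω : ℂ := cexp (2 * π * I / 3)
  have hf : D.f = cuspFormEtaProductTwentySeven := NonVacuityTwentySeven.f_eq_etaProductTwentySeven D
  obtain ⟨L₁, hg2, hg3, hle⟩ := h2
  show |D.c| = 1
  set c : ℤ := D.c with hc_def
  have hc0 : (c : ℂ) ≠ 0 := by
    intro hc
    have hω₁ : D.L.ω₁ ≠ 0 := by simpa using D.L.indep.ne_zero 0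
    obtain ⟨w, -, hw⟩ := hopt D.L.ω₁ D.L.ω₁_mem_lattice
    rw [hc, zero_mul] at hw
    exact hω₁ hw
  have hMω : ∀ z ∈ D.L.lattice, ω * z ∈ D.L.lattice := by
    intro z hz
    obtain ⟨w, hw, rfl⟩ := hopt z hz
    have hw' : ω * w ∈ periodLattice D.f := by
      rw [hf] at hw ⊢; exact h1 _ hw
    have := D.smul_periodLattice_le _ hw'
    convert this using 1; ring
  set P : PeriodPair := L₁.mulLeft (c : ℂ) hc0 with hP
  have hMP : D.L.lattice ≤ P.lattice := by
    intro z hz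
    obtain ⟨w, hw, rfl⟩ := hopt z hz
    rw [hf] at hw
    exact PeriodPair.mul_mem_mulLeft_lattice.mpr (hle w hw)
  have hL₁ω : ∀ z ∈ L₁.lattice, ω * z ∈ L₁.lattice := by
    have heq : (L₁.mulLeft ω hω0).lattice = L₁.lattice := by
      apply PeriodPair.uniformization_unique_holds
      · rw [PeriodPair.g₂_mulLeft, hg2, mul_zero]
      · rw [PeriodPair.g₃_mulLeft, hg3, hω6, inv_one, one_mul]
    intro z hz
    rw [← heq]
    exact PeriodPair.mul_mem_mulLeft_lattice.mpr hz
  have hPω : ∀ z ∈ P.lattice, ω * z ∈ P.lattice := by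
    intro z hz
    rw [hP, PeriodPair.mem_mulLeft_lattice] at hz ⊢
    have := hL₁ω _ hz
    convert this using 1; ring
  obtain ⟨a, b, hν, hMeq⟩ := lattice_eq_mulLeft_of_omega_stable hre him hMω hPω hMP
  set ν : ℂ := (a : ℂ) + b * ω with hν_def
  have hg2W : D.L.g₂ = 0 := by
    rw [PeriodPair.g₂_eq_of_lattice_eq hMeq, PeriodPair.g₂_mulLeft, hP, PeriodPair.g₂_mulLeft, hg2]
    ring
  have hg3W : D.L.g₃ = (ν ^ 6)⁻¹ * (((c : ℂ) ^ 6)⁻¹ * 27) := by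
    rw [PeriodPair.g₃_eq_of_lattice_eq hMeq, PeriodPair.g₃_mulLeft, hP, PeriodPair.g₃_mulLeft, hg3]
  have hN2 : D.L.g₂ = (W.baseChange ℂ).c₄ / 12 := D.isNeronLattice.1
  have hN3 : D.L.g₃ = (W.baseChange ℂ).c₆ / 216 := D.isNeronLattice.2
  set Wℤ : WeierstrassCurve ℤ := integralModelInt W with hWℤ
  have hW : Wℤ.map (Int.castRingHom ℚ) = W := map_integralModelInt W
  have hc4 : (W.baseChange ℂ).c₄ = (Wℤ.c₄ : ℂ) := by
    conv_lhs => rw [← hW]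
    simp [WeierstrassCurve.baseChange, WeierstrassCurve.map_c₄]
  have hc6 : (W.baseChange ℂ).c₆ = (Wℤ.c₆ : ℂ) := by
    conv_lhs => rw [← hW]
    simp [WeierstrassCurve.baseChange, WeierstrassCurve.map_c₆]
  set m : ℤ := Wℤ.c₆ with hm
  have h4 : Wℤ.c₄ = 0 := by
    have h : (Wℤ.c₄ : ℂ) / 12 = 0 := by rw [← hc4, ← hN2, hg2W]
    have : (Wℤ.c₄ : ℂ) = 0 := by
      rcases div_eq_zero_iff.mp h with h | h
      · exact h
      · norm_num at h
    exact_mod_cast this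
  have key : (m : ℂ) * (ν ^ 6 * (c : ℂ) ^ 6) = 5832 := by
    have h : (ν ^ 6)⁻¹ * (((c : ℂ) ^ 6)⁻¹ * 27) = (m : ℂ) / 216 := by rw [← hg3W, hN3, hc6]
    have hν6 : ν ^ 6 ≠ 0 := pow_ne_zero _ hν
    have hc6' : (c : ℂ) ^ 6 ≠ 0 := pow_ne_zero _ hc0
    have e1 : (ν ^ 6)⁻¹ * (((c : ℂ) ^ 6)⁻¹ * 27) * (ν ^ 6 * (c : ℂ) ^ 6) * 216 = 5832 := by
      field_simp; norm_num
    have e2 : (m : ℂ) / 216 * (ν ^ 6 * (c : ℂ) ^ 6) * 216 = (m : ℂ) * (ν ^ 6 * (c : ℂ) ^ 6) := by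
      ring
    rw [← e2, ← h, e1]
  set n : ℤ := a ^ 2 - a * b + b ^ 2 with hn_def
  have hn : Complex.normSq ν = (n : ℝ) := by
    rw [hν_def, hn_def]
    push_cast
    have := normSq_add_mul hre him a b
    push_cast at this
    exact this
  have hn1 : 1 ≤ n := by
    have : (0 : ℝ) < n := by rw [← hn]; exact Complex.normSq_pos.mpr hν
    exact_mod_cast this
  have hR : |(m : ℝ)| * (((c : ℝ) ^ 2 * (n : ℝ)) ^ 3) = 5832 := by
    have hnorm := congrArg (‖·‖) key
    simp only [norm_mul, norm_pow, Complex.norm_intCast] at hnorm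
    have h5832 : ‖(5832 : ℂ)‖ = 5832 := by
      rw [show (5832 : ℂ) = ((5832 : ℕ) : ℂ) by norm_num, Complex.norm_natCast]; norm_num
    have hν2 : ‖ν‖ ^ 2 = (n : ℝ) := by rw [Complex.sq_norm, hn]
    have hc2 : |(c : ℝ)| ^ 2 = (c : ℝ) ^ 2 := sq_abs _
    calc |(m : ℝ)| * (((c : ℝ) ^ 2 * (n : ℝ)) ^ 3)
        = |(m : ℝ)| * ((‖ν‖ ^ 2) ^ 3 * (|(c : ℝ)| ^ 2) ^ 3) := by rw [hν2, hc2]; ring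
      _ = |(m : ℝ)| * (‖ν‖ ^ 6 * |(c : ℝ)| ^ 6) := by ring
      _ = 5832 := by rw [hnorm, h5832]
  have hZ : |m| * (c ^ 2 * n) ^ 3 = 5832 := by exact_mod_cast hR
  have hΔ : 1728 * Wℤ.Δ = -m ^ 2 := by rw [Wℤ.c_relation, h4]; ring
  exact abs_eq_one_of_arith m Wℤ.Δ c n hn1 hΔ hZ

/-! ## §4 Corollaries in the shape of the route items at `N = 27` -/

/-- C3 `ManinPrimeToThreeAtNine` at `N = 27`, fact-free modulo (S2): `3 ∤ c(D)` for every globally minimal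
`W` and every `X₀(27)`-datum with the lattice clause. [folklore] -/
theorem not_three_dvd_maninConstant_twentySeven_of_periodLattice_le_hex
    (h2 : ∃ L₁ : PeriodPair, L₁.g₂ = 0 ∧ L₁.g₃ = 27 ∧
      ∀ z ∈ periodLattice cuspFormEtaProductTwentySeven, z ∈ L₁.lattice)
    (W : WeierstrassCurve ℚ) [W.IsGloballyMinimal] (D : ModularParametrizationData W 27)
    (hopt : ∀ z ∈ D.L.lattice, ∃ w ∈ periodLattice D.f, z = D.c * w) :
    ¬ (3 : ℤ) ∣ D.maninConstant := by
  have h := abs_maninConstant_eq_one_twentySeven_of_periodLattice_le_hex h2 W D hopt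
  intro h3
  have := Int.le_of_dvd (by rw [h]; norm_num) ((dvd_abs _ _).mpr h3)
  rw [h] at this
  norm_num at this

end Summit.BirchSwinnertonDyer.BirchSwinnertonDyer.Theorems.ManinLocalTwoThree.HexagonalSqueezeTwentySeven
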